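import Mathlib
import HarnessLib
import Summits.CriticalPhenomena.CardyFormulaZ2.Theorems.CardyComplexConeEdgeCoherenceLeeYangDefs
import Summits.CriticalPhenomena.CardyFormulaZ2.Theorems.CardyComplexConeEdgeCoherenceStubFactorisationOrbit

/-!
# Stub `stub_laurent` of line `Sketch` (composition `LeeYang`) for crux `CardyComplexCone.EdgeCoherence`

Route `CardyComplexCone` (sub-problem `CriticalPhenomena/CardyFormulaZ2`), crux
`Summit.CriticalPhenomena.CardyFormulaZ2.Theses.CardyComplexCone.EdgeCoherence` (item stmt-CriticalPhenomena-11385).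
Helper file `--supports stmt-CriticalPhenomena-11385`: it proves, by name, the registered stub
`stub_laurent : Sig.stub_laurent` of the definitions module
`Theorems/CardyComplexConeEdgeCoherenceLeeYangDefs.lean`, i.e. **LAURENT**: for admissible data `E` the
winding-index generating function `Z(ζ) = indexGF E δ v ζ` is holomorphic off the origin,
`DifferentiableOn ℂ (indexGF E δ v) {z | z ≠ 0}`.

## Content and proof

`Z(ζ) = ∫ G(ω, ζ) dP_{1/2}(ω)` where the pathwise integrand `G(ω, ζ)` is a finite double sum of integer powers
`ζ ^ m`, `m ∈ ℤ`, indexed by the darts of the exploration path `γ = medialExploration E ω` at `v`. The path reads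
`ω` only on the edge set `S = E(Ω_δ)` of the discrete domain (`medialExploration_inter_edgeSet`, no admissibility
needed), and `S` is finite for admissible data (`edgeSet_finite`). Hence `ω ↦ G(ω, ζ)` is a *local functional*:
`G(ω, ζ) = G(ω ∩ S, ζ)`, and a local functional of bond percolation is a finite linear combination of indicators of
the fibres `{ω | ω ∩ S = A}`, `A ⊆ S` (measurable, `measurable_of_forall_inter`), so its Bochner integral against
the probability measure `P_{1/2}` is the FINITE sum `Σ_{A ⊆ S} P{ω ∩ S = A} · G(A, ζ)`
(`integral_eq_sum_of_forall_inter`, from `integral_finsetSum` and `integral_indicator_const`). Each `G(A, ·)` is a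
finite sum of `ζ ↦ ζ ^ m`, differentiable on `{z | z ≠ 0}` (`differentiableOn_zpow`), and finite sums and
constant multiples of differentiable functions are differentiable (`DifferentiableOn.fun_sum`, `.const_mul`;
packaged as `differentiableOn_integral_of_forall_inter`, holomorphy of the integral of a local functional).

Sources: H. Duminil-Copin, S. Smirnov, *Conformal invariance of lattice models*, Clay Math. Proc. 15 (2012)
§6.2 (locality of the exploration), §8 (the spin-`1/3` observable); idea card
`Cruxes/EdgeCoherence/Ideas/lee-yang-winding-fugacity.md`. All analysis is elementary and proved inline.
-/

noncomputable section

namespace Summit.CriticalPhenomena.CardyFormulaZ2.Cruxes.EdgeCoherence.LeeYang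

open scoped BigOperators Topology
open Filter Set MeasureTheory
open Literature.Probability.LatticeModels Literature.Probability.RandomPlanarGeometry
open Literature.Probability.Percolation (BondConfig bondPercolation half)
open Summit.CriticalPhenomena.CardyFormulaZ2.Cruxes.EdgeCoherence.FixedRadiusCut
  (measurable_of_forall_inter medialExploration_inter_edgeSet edgeSet_finite)

/-! ### Local functionals: the integral is a finite sum over the fibres of `ω ↦ ω ∩ S` -/

/-- The fibres `{ω | ω ∩ S = A}` of the restriction to a finite set `S` of pairs are measurable. -/
theorem measurableSet_inter_eq {V : Type*} {S : Set (Sym2 V)} (hS : S.Finite) (A : Set (Sym2 V)) :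
    MeasurableSet {ω : BondConfig V | ω ∩ S = A} :=
  measurableSet_setOf.2 (measurable_of_forall_inter hS (F := fun ω : BondConfig V => ω ∩ S = A)
    (fun ω => by simp only [Set.inter_assoc, Set.inter_self]))

/-- **Finite-sum representation.** A local functional `F` (reading only the pairs of a finite set `S`,
`F ω = F (ω ∩ S)`) has, under any finite measure on configurations, the integral
`∫ F dμ = Σ_{A ⊆ S} μ{ω | ω ∩ S = A} · F A`. -/
theorem integral_eq_sum_of_forall_inter {V : Type*} {S : Set (Sym2 V)} (hS : S.Finite)
    (μ : Measure (BondConfig V)) [IsFiniteMeasure μ] {F : BondConfig V → ℂ}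
    (hF : ∀ ω, F ω = F (ω ∩ S)) :
    ∫ ω, F ω ∂μ = ∑ A ∈ hS.finite_subsets.toFinset, μ.real {ω : BondConfig V | ω ∩ S = A} * F A := by
  classical
  have hpt : ∀ ω, F ω = ∑ A ∈ hS.finite_subsets.toFinset,
      {ω' : BondConfig V | ω' ∩ S = A}.indicator (fun _ => F A) ω := by
    intro ω
    rw [Finset.sum_eq_single (ω ∩ S)]
    · rw [Set.indicator_of_mem (by simp)]
      exact hF ω
    · intro A _ hA
      exact Set.indicator_of_notMem (fun h : ω ∩ S = A => hA h.symm) _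
    · intro h
      exact absurd (by simp [Set.Finite.mem_toFinset]) h
  calc ∫ ω, F ω ∂μ
      = ∫ ω, ∑ A ∈ hS.finite_subsets.toFinset,
          {ω' : BondConfig V | ω' ∩ S = A}.indicator (fun _ => F A) ω ∂μ :=
        integral_congr_ae (ae_of_all _ hpt)
    _ = ∑ A ∈ hS.finite_subsets.toFinset,
          ∫ ω, {ω' : BondConfig V | ω' ∩ S = A}.indicator (fun _ => F A) ω ∂μ :=
        integral_finsetSum _ fun A _ => (integrable_const (F A)).indicator (measurableSet_inter_eq hS A)
    _ = ∑ A ∈ hS.finite_subsets.toFinset, μ.real {ω : BondConfig V | ω ∩ S = A} * F A :=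
        Finset.sum_congr rfl fun A _ => by
          rw [integral_indicator_const _ (measurableSet_inter_eq hS A), Complex.real_smul]

/-- **Holomorphy of the integral of a local functional.** If `G ω : ℂ → ℂ` reads `ω` only on a finite set `S`
of pairs and each `G ω` is differentiable on `U`, then `ζ ↦ ∫ G ω ζ dμ` is differentiable on `U` for every
finite measure `μ`: by `integral_eq_sum_of_forall_inter` it is the finite sum `Σ_{A ⊆ S} μ{ω ∩ S = A} · G A`. -/
theorem differentiableOn_integral_of_forall_inter {V : Type*} {S : Set (Sym2 V)} (hS : S.Finite)
    (μ : Measure (BondConfig V)) [IsFiniteMeasure μ] {G : BondConfig V → ℂ → ℂ}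
    (hG : ∀ ω, G ω = G (ω ∩ S)) {U : Set ℂ} (hd : ∀ ω, DifferentiableOn ℂ (G ω) U) :
    DifferentiableOn ℂ (fun ζ => ∫ ω, G ω ζ ∂μ) U := by
  have hrepr : (fun ζ => ∫ ω, G ω ζ ∂μ) =
      fun ζ => ∑ A ∈ hS.finite_subsets.toFinset, μ.real {ω : BondConfig V | ω ∩ S = A} * G A ζ :=
    funext fun ζ => integral_eq_sum_of_forall_inter hS μ fun ω => congrFun (hG ω) ζ
  rw [hrepr]
  exact DifferentiableOn.fun_sum fun A _ => (hd A).const_mul _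

/-! ### The stub -/

/-- **Stub LAURENT** (registered stub of line `Sketch`, composition `LeeYang`): for admissible data the
winding-index generating function `Z = indexGF E δ v` is holomorphic on `{z | z ≠ 0}`. The pathwise integrand
reads `ω` only on the finite edge set `E(Ω_δ)` (`medialExploration_inter_edgeSet`, `edgeSet_finite`), so `Z` is
the finite sum `Σ_{A ⊆ E(Ω_δ)} P{ω ∩ E(Ω_δ) = A} · G(A, ·)` of finite sums of integer powers `ζ ^ m`, each
differentiable off the origin (`differentiableOn_zpow`). -/
theorem stub_laurent : Sig.stub_laurent := by
  intro E δ v hE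
  refine differentiableOn_integral_of_forall_inter (edgeSet_finite hE) _ (fun ω => ?_) (fun ω => ?_)
  · funext ζ
    simp only [medialExploration_inter_edgeSet]
  · exact DifferentiableOn.fun_sum fun c _ => DifferentiableOn.fun_sum fun k _ =>
      differentiableOn_zpow _ _ (Or.inl fun h => h rfl)

end Summit.CriticalPhenomena.CardyFormulaZ2.Cruxes.EdgeCoherence.LeeYang

end
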